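import Summits.QuantumFields.YangMills.Theorems.TwistedTraceScaling.Negative.ConstProximityCentreTwist
import Summits.QuantumFields.YangMills.Theorems.LuscherReductionTwistedTraceScalingValleySchurDoor
import Summits.QuantumFields.YangMills.Theorems.LuscherReductionRunningReductionPolyakovLine
import Summits.QuantumFields.YangMills.Theorems.LuscherReductionRunningReductionTraceFormulaAveraging
import Summits.QuantumFields.YangMills.Theorems.LuscherReductionRunningReductionCoarseUpperScales
import HarnessLib

/-!
# Kit for negative lemma R10 (crux `TwistedTraceScaling`, stmt-QuantumFields-20203): unequal-angle two-link witnesses inside lane A's valley set,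
# and the commuting-pair obstructions near a constant (even `L`) / near a flat configuration (every `L`)

Standing disprover `ym-cdisprove-20203-1` (gen 10).  Ingredients for `…Negative.ValleyConstProximity` (the refutation of «`U ∈ valleySet L δ η ⇒`
mod gauge `√η`-close to a CONSTANT / to FLAT» for all scales `δ, η → 0`):
* §1 `min_le_of_commute_near_axes` — a COMMUTING pair `(X, Y)` within `Δ` of two rotations about ORTHOGONAL axes with sines `s_a`, `s_b` forces
  `min(s_a, s_b) ≤ 2Δ` (R8's `sq_le_of_commute_near_axes` is the equal-angle case);
* §2 the witness `twoLinkCfg a_α b_τ` with UNEQUAL angles: action `≤ 4·#Plaquette·sin²α·sin²τ` (`wilsonAction_twoLinkCfg_le₂`), direction-0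
  Polyakov line `a^n` in lane A's `lineProd` currency, and — the point — ALL EIGHT centre-twisted copies of it (and of its 't Hooft twist
  `twist 2 (−1) ·`) stay at orbit distance `≥ α/2` from the pure gauges (`orbitDist_twist3_twoLinkCfg_ge`: `Re tr P₀ = ±2cos(Lα)` against lane A's
  `re_trace_lineProd_ge_of_orbitDist_lt`), hence membership in `valleySet L δ η` whenever `δ < α` and `4·#P·sin²α·sin²τ < 2η`
  (`twoLinkCfg_mem_valleySet`, `twist_twoLinkCfg_mem_valleySet`);
* §3 the obstructions with unequal angles: `min_sin_le_of_near_const` (even `L`; R9's even-power rigidity / almost-commutation / commuting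
  shadows chain verbatim, new last line) and `min_sin_le_of_near_flat` (every `L`; R8's commuting line holonomies).
HONEST FRAMING: fixed-lattice `SU(2)` geometry; femto rung R2b1, stub support of a child of a CONDITIONAL reduction route; not a gap, not Clay.
Sorry-free, no new definition; axioms ⊆ {propext, Classical.choice, Quot.sound}.
-/

set_option autoImplicit false

noncomputable section

open Filter Topology
open scoped Matrix Quaternion BigOperators
open Literature.MathematicalPhysics.QuantumFieldTheory hiding SU2
open Literature.MathematicalPhysics.QuantumLattice
open Summit.QuantumFields.YangMills.Theorems.FemtoTransferGap
open Summit.QuantumFields.YangMills.Theorems.FemtoTransferGap.PhysL2 (twoLinkCfg plaquetteHolonomy_twoLinkCfg scalarPart_comm_eq)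
open Summit.QuantumFields.YangMills.Theorems.FemtoTransferGap.TwoLattice.Chart (frobNorm_sub_sq_eq)
open Summit.QuantumFields.YangMills.Theorems.FemtoTransferGap.TwoLattice.Cov (hol wilsonAction_eq_sum_scalarPart)
open Summit.QuantumFields.YangMills.Theorems.TwistedTraceScaling.Negative.R8
open Summit.QuantumFields.YangMills.Theorems.TwistedTraceScaling.Negative.R9

namespace Summit.QuantumFields.YangMills.Theorems.TwistedTraceScaling.Negative.R10

/-! ## §1 Commuting pairs near two rotations about orthogonal axes with unequal angles -/

section Quat

/-- The real-arithmetic core: coordinates `p ≈ s_a`, `u ≈ 0`, `w ≈ 0`, `q ≈ s_b` within `δ` (`s_a, s_b > 0`) satisfying the parallelism relation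
`p q = u w` force `min s_a s_b ≤ 2δ` (else `p, q > δ ≥ |u|, |w|`; no sign condition on `s_a, s_b` is needed). [folklore] -/
theorem min_le_two_mul_of_parallel {sa sb δ p q u w : ℝ} (hδ : 0 ≤ δ)
    (h1 : (sa - p) ^ 2 ≤ δ ^ 2) (h2 : u ^ 2 ≤ δ ^ 2) (h3 : w ^ 2 ≤ δ ^ 2) (h4 : (sb - q) ^ 2 ≤ δ ^ 2) (hc : p * q = u * w) :
    min sa sb ≤ 2 * δ := by
  by_contra hnot
  have hlt : 2 * δ < min sa sb := lt_of_not_ge hnot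
  have ha : 2 * δ < sa := hlt.trans_le (min_le_left _ _)
  have hb : 2 * δ < sb := hlt.trans_le (min_le_right _ _)
  have hp : δ < p := by obtain ⟨-, h⟩ := abs_le_of_sq_le_sq' h1 hδ; linarith
  have hq : δ < q := by obtain ⟨-, h⟩ := abs_le_of_sq_le_sq' h4 hδ; linarith
  have hu : |u| ≤ δ := abs_le_of_sq_le_sq h2 hδ
  have hw : |w| ≤ δ := abs_le_of_sq_le_sq h3 hδ
  have hpq : δ * δ < p * q := mul_lt_mul'' hp hq hδ hδ
  have huw : u * w ≤ δ * δ :=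
    calc u * w ≤ |u * w| := le_abs_self _
      _ = |u| * |w| := abs_mul u w
      _ ≤ δ * δ := mul_le_mul hu hw (abs_nonneg _) hδ
  rw [hc] at hpq
  exact lt_irrefl _ (hpq.trans_le huw)

/-- **The distance from a pair of rotations about ORTHOGONAL axes (angles with sines `s_a, s_b > 0`) to the commuting pairs is at least
`min(s_a, s_b)/2`**: if `A`, `B` have quaternions `(c_a, s_a, 0, 0)`, `(c_b, 0, s_b, 0)` and `X`, `Y` COMMUTE with `‖A − X‖_F ≤ δ`, `‖B − Y‖_F ≤ δ`,
then `min s_a s_b ≤ 2δ` (commuting elements of `SU(2)` have parallel vector parts; R8's `sq_le_of_commute_near_axes` is the case `s_a = s_b`). [folklore] -/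
theorem min_le_of_commute_near_axes {X Y A B : SU2} (hXY : X * Y = Y * X) {ca sa cb sb δ : ℝ}
    (hA : su2Quat A = ⟨ca, sa, 0, 0⟩) (hB : su2Quat B = ⟨cb, 0, sb, 0⟩)
    (hX : frobNorm ((A : Matrix (Fin 2) (Fin 2) ℂ) - (X : Matrix (Fin 2) (Fin 2) ℂ)) ≤ δ)
    (hY : frobNorm ((B : Matrix (Fin 2) (Fin 2) ℂ) - (Y : Matrix (Fin 2) (Fin 2) ℂ)) ≤ δ) : min sa sb ≤ 2 * δ := by
  have hδ : 0 ≤ δ := (frobNorm_nonneg _).trans hX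
  obtain ⟨hAr, hAi, hAj, hAk⟩ := entries_of_su2Quat_eq hA
  obtain ⟨hBr, hBi, hBj, hBk⟩ := entries_of_su2Quat_eq hB
  have hXsq : 2 * ((scalarPart A - scalarPart X) ^ 2 + ∑ t, (vecPart A t - vecPart X t) ^ 2) ≤ δ ^ 2 := by
    rw [← frobNorm_sub_sq_eq]; exact pow_le_pow_left₀ (frobNorm_nonneg _) hX 2
  have hYsq : 2 * ((scalarPart B - scalarPart Y) ^ 2 + ∑ t, (vecPart B t - vecPart Y t) ^ 2) ≤ δ ^ 2 := by
    rw [← frobNorm_sub_sq_eq]; exact pow_le_pow_left₀ (frobNorm_nonneg _) hY 2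
  simp only [Fin.sum_univ_three, scalarPart_eq, vecPart_zero, vecPart_one, vecPart_two, hAr, hAi, hAj, hAk, hBr, hBi, hBj, hBk] at hXsq hYsq
  have hδ2 := sq_nonneg δ
  refine min_le_two_mul_of_parallel (p := ((X : Matrix (Fin 2) (Fin 2) ℂ) 0 0).im) (q := ((Y : Matrix (Fin 2) (Fin 2) ℂ) 0 1).re)
    (u := ((X : Matrix (Fin 2) (Fin 2) ℂ) 0 1).re) (w := ((Y : Matrix (Fin 2) (Fin 2) ℂ) 0 0).im) hδ ?_ ?_ ?_ ?_ (im_mul_re_eq_of_commute hXY)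
  · nlinarith [sq_nonneg (ca - ((X : Matrix (Fin 2) (Fin 2) ℂ) 0 0).re), sq_nonneg (0 - ((X : Matrix (Fin 2) (Fin 2) ℂ) 0 1).re),
      sq_nonneg (0 - ((X : Matrix (Fin 2) (Fin 2) ℂ) 0 1).im)]
  · nlinarith [sq_nonneg (ca - ((X : Matrix (Fin 2) (Fin 2) ℂ) 0 0).re), sq_nonneg (sa - ((X : Matrix (Fin 2) (Fin 2) ℂ) 0 0).im),
      sq_nonneg (0 - ((X : Matrix (Fin 2) (Fin 2) ℂ) 0 1).im)]
  · nlinarith [sq_nonneg (cb - ((Y : Matrix (Fin 2) (Fin 2) ℂ) 0 0).re), sq_nonneg (sb - ((Y : Matrix (Fin 2) (Fin 2) ℂ) 0 1).re),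
      sq_nonneg (0 - ((Y : Matrix (Fin 2) (Fin 2) ℂ) 0 1).im)]
  · nlinarith [sq_nonneg (cb - ((Y : Matrix (Fin 2) (Fin 2) ℂ) 0 0).re), sq_nonneg (0 - ((Y : Matrix (Fin 2) (Fin 2) ℂ) 0 0).im),
      sq_nonneg (0 - ((Y : Matrix (Fin 2) (Fin 2) ℂ) 0 1).im)]

end Quat

/-! ## §2 The witness `twoLinkCfg a_α b_τ` (unequal angles): action `≤ 4·#P·sin²α·sin²τ`, Polyakov loop `a^L`, all eight twisted copies far from the
pure gauges -/

section Witness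
variable {L : ℕ}

/-- `scalarPart 1 = 1`. [folklore] -/
private theorem scalarPart_one'' : scalarPart (1 : SU2) = 1 := by
  simp [scalarPart_eq]

/-- **Every plaquette term of the witness is `≤ 4 sin²α sin²τ`** (`= 4 sin²α sin²τ = 4|u_a × u_b|²` in the `(0,1)` planes, `0` elsewhere).
[cite: Luscher1983, §2] -/
theorem plaqTerm_twoLinkCfg_le₂ {a b : SU2} {α τ : ℝ} (ha : su2Quat a = ⟨Real.cos α, Real.sin α, 0, 0⟩)
    (hb : su2Quat b = ⟨Real.cos τ, 0, Real.sin τ, 0⟩) (p : Plaquette 3 L) :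
    2 * (1 - scalarPart (plaquetteHolonomy (twoLinkCfg (L := L) a b) p.1 p.2.1.1 p.2.1.2)) ≤ 4 * (Real.sin α ^ 2 * Real.sin τ ^ 2) := by
  have h4 : 0 ≤ 4 * (Real.sin α ^ 2 * Real.sin τ ^ 2) := by positivity
  obtain ⟨-, ha0, ha1, ha2⟩ := entries_of_su2Quat_eq ha
  obtain ⟨-, hb0, hb1, hb2⟩ := entries_of_su2Quat_eq hb
  obtain ⟨x, ⟨⟨i, j⟩, hij⟩⟩ := p
  dsimp only at hij ⊢
  fin_cases i <;> fin_cases j <;> first | exact absurd hij (by decide) | skip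
  · -- the `(0,1)` plane: the commutator
    show 2 * (1 - scalarPart (plaquetteHolonomy (twoLinkCfg (L := L) a b) x 0 1)) ≤ 4 * (Real.sin α ^ 2 * Real.sin τ ^ 2)
    rw [plaquetteHolonomy_twoLinkCfg, scalarPart_comm_eq, cross_apply]
    simp only [vecPart_zero, vecPart_one, vecPart_two, ha0, ha1, ha2, hb0, hb1, hb2]
    simp [dotProduct, Fin.sum_univ_three]
    nlinarith [sq_nonneg (Real.sin α), sq_nonneg (Real.sin τ), mul_nonneg (sq_nonneg (Real.sin α)) (sq_nonneg (Real.sin τ))]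
  · -- the `(0,2)` plane: trivial
    simp [plaquetteHolonomy, twoLinkCfg, scalarPart_one'', h4]
  · -- the `(1,2)` plane: trivial
    simp [plaquetteHolonomy, twoLinkCfg, scalarPart_one'', h4]

/-- **The action of the witness**: `S(twoLinkCfg a_α b_τ) ≤ 4·#Plaquette·sin²α·sin²τ`. [cite: Luscher1983, §2] -/
theorem wilsonAction_twoLinkCfg_le₂ [NeZero L] {a b : SU2} {α τ : ℝ} (ha : su2Quat a = ⟨Real.cos α, Real.sin α, 0, 0⟩)
    (hb : su2Quat b = ⟨Real.cos τ, 0, Real.sin τ, 0⟩) :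
    wilsonAction su2Rep (twoLinkCfg (L := L) a b) ≤ 4 * (Fintype.card (Plaquette 3 L) : ℝ) * (Real.sin α ^ 2 * Real.sin τ ^ 2) := by
  rw [wilsonAction_eq_sum_scalarPart]
  calc ∑ p : Plaquette 3 L, 2 * (1 - scalarPart (hol (twoLinkCfg (L := L) a b) p))
      ≤ ∑ _p : Plaquette 3 L, 4 * (Real.sin α ^ 2 * Real.sin τ ^ 2) := Finset.sum_le_sum fun p _ => plaqTerm_twoLinkCfg_le₂ ha hb p
    _ = 4 * (Fintype.card (Plaquette 3 L) : ℝ) * (Real.sin α ^ 2 * Real.sin τ ^ 2) := by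
      rw [Finset.sum_const, Finset.card_univ, nsmul_eq_mul]; ring

/-- The direction-0 partial Polyakov lines of the witness (lane A's `lineProd`): `a^n`. [folklore] -/
theorem lineProd_twoLinkCfg_zero [NeZero L] (a b : SU2) (x : Site 3 L) : ∀ n : ℕ, lineProd (twoLinkCfg (L := L) a b) x 0 n = a ^ n
  | 0 => by simp
  | n + 1 => by
    rw [lineProd_succ, lineProd_twoLinkCfg_zero a b x n, pow_succ]
    simp [twoLinkCfg]

/-- **All eight twisted copies of the witness are far from the pure gauges**: `α/2 ≤ orbitDist (twist3 z (twoLinkCfg a_α b))` for `0 < α`,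
`Lα ≤ π/2` — the closed direction-0 Polyakov loop of `twist3 z (twoLinkCfg a b)` is `±a^L` with `Re tr = ±2cos(Lα)`, whereas `orbitDist < r` forces
`Re tr ≥ 2 − (Lr)²/2` (lane A's `re_trace_lineProd_ge_of_orbitDist_lt`). [cite: tHooft1979] -/
theorem orbitDist_twist3_twoLinkCfg_ge [NeZero L] {a : SU2} (b : SU2) {α : ℝ} (ha : su2Quat a = ⟨Real.cos α, Real.sin α, 0, 0⟩)
    (hα0 : 0 < α) (hαL : (L : ℝ) * α ≤ Real.pi / 2) (z : Fin 3 → Bool) :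
    α / 2 ≤ orbitDist (TT.twist3 z (twoLinkCfg (L := L) a b)) := by
  by_contra hlt
  have h := re_trace_lineProd_ge_of_orbitDist_lt (lt_of_not_ge hlt) (0 : Site 3 L) 0
  have hLpos : (0 : ℝ) < L := Nat.cast_pos.2 (Nat.pos_of_ne_zero (NeZero.ne L))
  have hπ := Real.pi_pos
  have hsc : scalarPart (a ^ L) = Real.cos (L * α) := by
    rw [scalarPart_eq]; exact (entries_of_su2Quat_eq (su2Quat_pow_axisI ha L)).1
  set θ := (L : ℝ) * α with hθ
  have hθ0 : 0 < θ := by positivity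
  have hθ4 : θ ^ 2 < 16 := by nlinarith [Real.pi_le_four]
  have hr : ((L : ℝ) * (α / 2)) ^ 2 / 2 = θ ^ 2 / 8 := by rw [hθ]; ring
  rw [hr] at h
  cases hz : z 0 with
  | false =>
    rw [lineProd_twist3_closed, hz, show TT.centreElem false = 1 by simp [TT.centreElem], one_mul, lineProd_twoLinkCfg_zero,
      re_trace_eq_two_mul_scalarPart, hsc] at h
    have hj : 2 / Real.pi * (θ / 2) ≤ Real.sin (θ / 2) := Real.mul_le_sin (by positivity) (by linarith)
    have hj' : θ ≤ Real.pi * Real.sin (θ / 2) := by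
      rw [div_mul_eq_mul_div, div_le_iff₀ hπ] at hj; linarith
    have hsn : 0 ≤ Real.sin (θ / 2) := le_trans (by positivity) hj
    have hcos : Real.cos θ = 1 - 2 * Real.sin (θ / 2) ^ 2 := by
      conv_lhs => rw [show θ = 2 * (θ / 2) by ring]
      rw [Real.cos_two_mul, Real.cos_sq']; ring
    rw [hcos] at h
    have h32 : 32 * Real.sin (θ / 2) ^ 2 ≤ θ ^ 2 := by linarith
    have hθsq : θ ^ 2 ≤ Real.pi ^ 2 * Real.sin (θ / 2) ^ 2 := by
      have := mul_le_mul hj' hj' hθ0.le (by positivity)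
      nlinarith [this]
    have h16 : Real.pi ^ 2 * Real.sin (θ / 2) ^ 2 ≤ 16 * Real.sin (θ / 2) ^ 2 :=
      mul_le_mul_of_nonneg_right (by nlinarith [Real.pi_le_four]) (sq_nonneg _)
    nlinarith [pow_pos hθ0 2]
  | true =>
    rw [re_trace_lineProd_twist3_true hz, lineProd_twoLinkCfg_zero, re_trace_eq_two_mul_scalarPart, hsc] at h
    have hcos : 0 ≤ Real.cos θ := Real.cos_nonneg_of_neg_pi_div_two_le_of_le (by linarith) hαL
    linarith

/-- The untwisted witness lies in the valley set: action `< 2η` and every twisted copy at orbit distance `> δ/2`. [folklore] -/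
theorem twoLinkCfg_mem_valleySet [NeZero L] {a b : SU2} {α τ δ η : ℝ} (ha : su2Quat a = ⟨Real.cos α, Real.sin α, 0, 0⟩)
    (hb : su2Quat b = ⟨Real.cos τ, 0, Real.sin τ, 0⟩) (hα0 : 0 < α) (hαL : (L : ℝ) * α ≤ Real.pi / 2) (hδ : δ < α)
    (hS : 4 * (Fintype.card (Plaquette 3 L) : ℝ) * (Real.sin α ^ 2 * Real.sin τ ^ 2) < 2 * η) :
    twoLinkCfg (L := L) a b ∈ valleySet L δ η :=
  mem_valleySet_iff.2 ⟨(wilsonAction_twoLinkCfg_le₂ ha hb).trans_lt hS, fun z => by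
    linarith [orbitDist_twist3_twoLinkCfg_ge b ha hα0 hαL z]⟩

/-- The centre-twisted witness `twist 2 (−1) (twoLinkCfg a b)` lies in the valley set (same plaquettes; its eight twisted copies are the eight twisted
copies of `twoLinkCfg a b`). [cite: tHooft1979] -/
theorem twist_twoLinkCfg_mem_valleySet [NeZero L] {a b : SU2} {α τ δ η : ℝ} (ha : su2Quat a = ⟨Real.cos α, Real.sin α, 0, 0⟩)
    (hb : su2Quat b = ⟨Real.cos τ, 0, Real.sin τ, 0⟩) (hα0 : 0 < α) (hαL : (L : ℝ) * α ≤ Real.pi / 2) (hδ : δ < α)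
    (hS : 4 * (Fintype.card (Plaquette 3 L) : ℝ) * (Real.sin α ^ 2 * Real.sin τ ^ 2) < 2 * η) :
    twist 2 negOne (twoLinkCfg (L := L) a b) ∈ valleySet L δ η := by
  refine mem_valleySet_iff.2 ⟨?_, fun z => ?_⟩
  · rw [wilsonAction_twist_of_mem_center su2Rep 2 negOne_mem_center]
    exact (wilsonAction_twoLinkCfg_le₂ ha hb).trans_lt hS
  · have hce : TT.centreElem true = negOne := by simp [TT.centreElem]
    rw [← hce, TT.twist_centreElem_eq_twist3, TT.twist3_twist3]
    refine lt_of_lt_of_le ?_ (orbitDist_twist3_twoLinkCfg_ge b ha hα0 hαL _)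
    linarith

end Witness

/-! ## §3 The obstructions: near a constant (even `L`, R9's chain) / near a flat configuration (every `L`, R8's chain) -/

section Obstruction
variable {L : ℕ}

set_option maxHeartbeats 400000 in
/-- **Near-constant obstruction, unequal angles** (even `L = m + m`): the five loop facts of a configuration `δ`-close to the constant `c` after gauge
(`g₀ a^L g₀⁻¹ ≈ c₀^L`, `g₀ b^L g₀⁻¹ ≈ c₁^L`, `−1 ≈ c₂^L` within `Lδ`; `1 ≈ [c₀,c₂]`, `1 ≈ [c₁,c₂]` within `4δ`) force
`min(sin(Lα), sin(Lτ)) ≤ 2L(1+2L)δ` — R9's steps (even-power rigidity, almost-commutation, commuting shadows, powers/conjugation) verbatim, finished by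
`min_le_of_commute_near_axes`. [folklore] -/
theorem min_sin_le_of_near_const {m : ℕ} (hm : L = m + m) (hL : 0 < L) {a b g₀ : SU2} {c : Fin 3 → SU2} {α τ δ : ℝ}
    (ha : su2Quat a = ⟨Real.cos α, Real.sin α, 0, 0⟩) (hb : su2Quat b = ⟨Real.cos τ, 0, Real.sin τ, 0⟩)
    (hε : (L : ℝ) * δ ≤ 1 / 2)
    (hd0 : frobNorm (((g₀ * a ^ L * g₀⁻¹ : SU2) : Matrix (Fin 2) (Fin 2) ℂ) - ((c 0 ^ L : SU2) : Matrix (Fin 2) (Fin 2) ℂ)) ≤ L * δ)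
    (hd1 : frobNorm (((g₀ * b ^ L * g₀⁻¹ : SU2) : Matrix (Fin 2) (Fin 2) ℂ) - ((c 1 ^ L : SU2) : Matrix (Fin 2) (Fin 2) ℂ)) ≤ L * δ)
    (hd2 : frobNorm (((negOne : SU2) : Matrix (Fin 2) (Fin 2) ℂ) - ((c 2 ^ L : SU2) : Matrix (Fin 2) (Fin 2) ℂ)) ≤ L * δ)
    (hp0 : frobNorm (1 - ((c 0 * c 2 * (c 0)⁻¹ * (c 2)⁻¹ : SU2) : Matrix (Fin 2) (Fin 2) ℂ)) ≤ 4 * δ)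
    (hp1 : frobNorm (1 - ((c 1 * c 2 * (c 1)⁻¹ * (c 2)⁻¹ : SU2) : Matrix (Fin 2) (Fin 2) ℂ)) ≤ 4 * δ) :
    min (Real.sin (L * α)) (Real.sin (L * τ)) ≤ 2 * (L * ((1 + 2 * L) * δ)) := by
  have hδ0 : 0 ≤ δ := by linarith [(frobNorm_nonneg _).trans hp0]
  have hLr : (0 : ℝ) < L := Nat.cast_pos.2 hL
  have hmL : (m : ℝ) = L / 2 := by rw [hm]; push_cast; ring
  have hm0 : (0 : ℝ) < (m : ℝ) ^ 2 := by rw [hmL]; positivity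
  -- (1) even-power rigidity for `c 2`
  set ν := ∑ i, vecPart (c 2) i ^ 2 with hν
  have hA : 1 - L * δ / 2 ≤ (m : ℝ) ^ 2 * ν := even_power_rigidity (c 2) m (by rw [← hm]; exact hd2)
  have hmν : 3 / 4 ≤ (m : ℝ) ^ 2 * ν := by nlinarith
  have hν0 : 0 < ν := by
    by_contra h
    have : (m : ℝ) ^ 2 * ν ≤ 0 := mul_nonpos_of_nonneg_of_nonpos hm0.le (not_lt.1 h)
    linarith
  -- (2) almost-commutation with `c 2`
  have hκ0 := cross_sq_le_of_comm_near_one hp0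
  have hκ1 := cross_sq_le_of_comm_near_one hp1
  rw [show (4 * δ) ^ 2 / 8 = 2 * δ ^ 2 by ring] at hκ0 hκ1
  have hLδ : (m : ℝ) ^ 2 * (4 * δ ^ 2) = (L * δ) ^ 2 := by rw [hmL]; ring
  have hLδ2 : ((L : ℝ) * δ) ^ 2 ≤ 1 / 4 := by nlinarith [mul_nonneg hLr.le hδ0]
  have hsmall : 2 * (2 * δ ^ 2) ≤ ν := by
    by_contra hcon
    have : (m : ℝ) ^ 2 * ν < (m : ℝ) ^ 2 * (4 * δ ^ 2) := mul_lt_mul_of_pos_left (by linarith) hm0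
    linarith
  -- (3) commuting shadows `Y0`, `Y1` of `c 0`, `c 1` on the axis of `c 2`
  obtain ⟨Y0, r0, t0, hY0, hY0d⟩ := exists_commuting_shadow (c 0) (c 2) hκ0 hsmall hν0
  obtain ⟨Y1, r1, t1, hY1, hY1d⟩ := exists_commuting_shadow (c 1) (c 2) hκ1 hsmall hν0
  have hcomm : Y0 * Y1 = Y1 * Y0 := comm_of_parallel hY0 hY1
  have hdist : ∀ {F : ℝ}, 0 ≤ F → F ^ 2 * ν ≤ 4 * (2 * δ ^ 2) → F ≤ 2 * L * δ := fun {F} hF h => by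
    have h1 : F ^ 2 * ((m : ℝ) ^ 2 * ν) ≤ 2 * (L * δ) ^ 2 := by nlinarith [hm0.le]
    have h2 : F ^ 2 * (3 / 4) ≤ F ^ 2 * ((m : ℝ) ^ 2 * ν) := mul_le_mul_of_nonneg_left hmν (sq_nonneg F)
    have h3 : F ^ 2 ≤ (2 * L * δ) ^ 2 := by nlinarith
    exact (pow_le_pow_iff_left₀ hF (by positivity) two_ne_zero).1 h3
  have hF0 : frobNorm ((c 0 : Matrix (Fin 2) (Fin 2) ℂ) - (Y0 : Matrix (Fin 2) (Fin 2) ℂ)) ≤ 2 * L * δ := hdist (frobNorm_nonneg _) hY0d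
  have hF1 : frobNorm ((c 1 : Matrix (Fin 2) (Fin 2) ℂ) - (Y1 : Matrix (Fin 2) (Fin 2) ℂ)) ≤ 2 * L * δ := hdist (frobNorm_nonneg _) hY1d
  -- (4) powers, triangle, conjugation
  have hP0 : frobNorm (((c 0 ^ L : SU2) : Matrix (Fin 2) (Fin 2) ℂ) - ((Y0 ^ L : SU2) : Matrix (Fin 2) (Fin 2) ℂ)) ≤ L * (2 * L * δ) :=
    (frobNorm_pow_sub_pow_le' (c 0) Y0 L).trans (mul_le_mul_of_nonneg_left hF0 (Nat.cast_nonneg L))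
  have hP1 : frobNorm (((c 1 ^ L : SU2) : Matrix (Fin 2) (Fin 2) ℂ) - ((Y1 ^ L : SU2) : Matrix (Fin 2) (Fin 2) ℂ)) ≤ L * (2 * L * δ) :=
    (frobNorm_pow_sub_pow_le' (c 1) Y1 L).trans (mul_le_mul_of_nonneg_left hF1 (Nat.cast_nonneg L))
  have hC0 : frobNorm (((a ^ L : SU2) : Matrix (Fin 2) (Fin 2) ℂ) - ((g₀⁻¹ * Y0 ^ L * g₀ : SU2) : Matrix (Fin 2) (Fin 2) ℂ)) ≤ L * ((1 + 2 * L) * δ) := by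
    rw [← frobNorm_conj_sub]
    have := (frobNorm_sub_le_of_mid _ ((c 0 ^ L : SU2) : Matrix (Fin 2) (Fin 2) ℂ) _).trans (add_le_add hd0 hP0)
    linarith
  have hC1 : frobNorm (((b ^ L : SU2) : Matrix (Fin 2) (Fin 2) ℂ) - ((g₀⁻¹ * Y1 ^ L * g₀ : SU2) : Matrix (Fin 2) (Fin 2) ℂ)) ≤ L * ((1 + 2 * L) * δ) := by
    rw [← frobNorm_conj_sub]
    have := (frobNorm_sub_le_of_mid _ ((c 1 ^ L : SU2) : Matrix (Fin 2) (Fin 2) ℂ) _).trans (add_le_add hd1 hP1)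
    linarith
  set A := Y0 ^ L with hAdef
  set B := Y1 ^ L with hBdef
  have hAB : A * B = B * A := (Commute.pow_pow hcomm L L).eq
  have hXY : g₀⁻¹ * A * g₀ * (g₀⁻¹ * B * g₀) = g₀⁻¹ * B * g₀ * (g₀⁻¹ * A * g₀) := by
    calc g₀⁻¹ * A * g₀ * (g₀⁻¹ * B * g₀) = g₀⁻¹ * (A * B) * g₀ := by group
      _ = g₀⁻¹ * (B * A) * g₀ := by rw [hAB]
      _ = g₀⁻¹ * B * g₀ * (g₀⁻¹ * A * g₀) := by group
  have h := min_le_of_commute_near_axes hXY (su2Quat_pow_axisI ha L) (su2Quat_pow_axisJ hb L) hC0 hC1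
  linarith

/-- **Near-flat obstruction, unequal angles** (every `L`): if `twoLinkCfg a_α b_τ` is `r`-close per link to a FLAT configuration `V`, then
`min(sin(Lα), sin(Lτ)) ≤ 2Lr` — the full-period line holonomies of `V` through the origin commute (R8) and are within `Lr` of `a^L`, `b^L`. [folklore] -/
theorem min_sin_le_of_near_flat [NeZero L] {a b : SU2} {α τ r : ℝ}
    (ha : su2Quat a = ⟨Real.cos α, Real.sin α, 0, 0⟩) (hb : su2Quat b = ⟨Real.cos τ, 0, Real.sin τ, 0⟩)
    {V : GaugeConfig 3 L SU2} (hV : ∀ x i j, plaquetteHolonomy V x i j = 1)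
    (hclose : ∀ e, frobNorm (((twoLinkCfg (L := L) a b e : SU2) : Matrix (Fin 2) (Fin 2) ℂ) - ((V e : SU2) : Matrix (Fin 2) (Fin 2) ℂ)) ≤ r) :
    min (Real.sin (L * α)) (Real.sin (L * τ)) ≤ 2 * (L * r) := by
  have hd0 := frobNorm_lineHolonomy_sub_le hclose 0 L 0
  have hd1 := frobNorm_lineHolonomy_sub_le hclose 1 L 0
  rw [lineHolonomy_twoLinkCfg_zero] at hd0
  rw [lineHolonomy_twoLinkCfg_one] at hd1
  have hcommV := lineHolonomy_comm_of_flat hV 0 1 (0 : Site 3 L)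
  exact min_le_of_commute_near_axes hcommV (su2Quat_pow_axisI ha L) (su2Quat_pow_axisJ hb L) hd0 hd1

end Obstruction

end Summit.QuantumFields.YangMills.Theorems.TwistedTraceScaling.Negative.R10

end
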